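import Mathlib.GroupTheory.GroupAction.Quotient
import Mathlib.Data.Set.Card
import Mathlib.Tactic.Group
import Mathlib.GroupTheory.GroupAction.FixedPoints
import Mathlib.Algebra.BigOperators.Finprod
import HarnessLib

/-!
# The coset space of `G × A` by `K × A` is the coset space of `G` by `K`, equivariantly; fixed points and fixed-point sums along a trivialised factor

Topic `GroupTheory`; namespace `Literature.GroupTheory`.  THEOREMS ONLY (no definition, no instance, no notation, no named fact, no `sorry`); Mathlib-only.  Generic
lemma of the road «R1LL-tree» (cell `pub/hodgecm-mathlib`, crux H413 = `stmt-HodgeConjecture-24833`; architect A-p16 (g27), RULING A-11, brick I-7 «`H_v` transport»), where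
`G × A = U(Φ₂)_v × U(Φ₁)_v` and the compact factor `A = U(Φ₁)_v` lies inside every vertex stabiliser `K × A`: orbital fixed-point counts and fixed-point sums on
`(G × A) ⧸ (K × A)` are those on `G ⧸ K`.

* `mk_prod_eq_mk_prod_iff` — `mk (g, a) = mk (g′, a′) ↔ mk g = mk g′` in `(G × A) ⧸ K.prod ⊤` ∕ `G ⧸ K`.
* `exists_equiv_quotient_prod_top` — an `Equiv` `e : (G × A) ⧸ K.prod ⊤ ≃ G ⧸ K` with `e (mk (g, a)) = mk g` and `e ((γ, α) • q) = γ • e q`.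
* `mem_fixedBy_prod_iff` — `q ∈ Fix_{(γ,α)} ↔ e q ∈ Fix_γ`; `natCard_fixedBy_quotient_prod_top_eq` — `#Fix_{(γ,α)}((G × A) ⧸ K × A) = #Fix_γ(G ⧸ K)`;
  `ncard_sep_fixedBy_quotient_prod_top_eq` — the same for the sub-counts `#{q ∈ Fix | p (e q)}` against `#{p′ ∈ Fix | p p′}` (depth strata).
* `apply_out_conj_eq_of_conj_invariant` — for `f : G × A → E` invariant under conjugation by `K × A`: `f (q.out⁻¹ (γ, α) q.out) = f ((e q).out⁻¹ γ (e q).out, α)`;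
  `finsum_mem_fixedBy_quotient_prod_top_eq` — `Σᶠ_{q ∈ Fix_{(γ,α)}} f (q.out⁻¹ (γ,α) q.out) = Σᶠ_{p ∈ Fix_γ} f (p.out⁻¹ γ p.out, α)`.
[BourbakiAlgebraI1989, Ch. I §5 no. 5 (groups operating on a set; homogeneous spaces); Laumon1995 Lemma (5.3.2) (fixed points on `G ⧸ K` in orbital integrals)]

## References
* [BourbakiAlgebraI1989] N. Bourbaki, *Algebra I, Chapters 1–3* (1989), Ch. I §5 no. 5–7 (operations of groups, homogeneous spaces, products).
* [Laumon1995] G. Laumon, *Cohomology of Drinfeld Modular Varieties* I (1996), Lemma (5.3.2) p. 136.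
-/

namespace Literature.GroupTheory

open MulAction

variable {G A : Type*} [Group G] [Group A] (K : Subgroup G)

/-- `mk (g, a) = mk (g′, a′)` in `(G × A) ⧸ (K × A)` iff `mk g = mk g′` in `G ⧸ K`. [cite: BourbakiAlgebraI1989, Ch. I §5 no. 5] -/
theorem mk_prod_eq_mk_prod_iff (g g' : G) (a a' : A) :
    (QuotientGroup.mk (g, a) : (G × A) ⧸ K.prod ⊤) = QuotientGroup.mk (g', a') ↔ (QuotientGroup.mk g : G ⧸ K) = QuotientGroup.mk g' := by
  rw [QuotientGroup.eq, QuotientGroup.eq, Subgroup.mem_prod]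
  simp only [Prod.inv_mk, Prod.mk_mul_mk, Subgroup.mem_top, and_true]

/-- **`(G × A) ⧸ (K × A) ≃ G ⧸ K`, equivariantly** (`(g, a) ↦ g`). [cite: BourbakiAlgebraI1989, Ch. I §5 no. 5] -/
theorem exists_equiv_quotient_prod_top :
    ∃ e : (G × A) ⧸ K.prod ⊤ ≃ G ⧸ K, (∀ g : G, ∀ a : A, e (QuotientGroup.mk (g, a)) = QuotientGroup.mk g) ∧
      ∀ (γ : G) (α : A) (q : (G × A) ⧸ K.prod ⊤), e ((γ, α) • q) = γ • e q := by
  classical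
  let toFun : (G × A) ⧸ K.prod ⊤ → G ⧸ K := fun q => QuotientGroup.mk q.out.1
  let invFun : G ⧸ K → (G × A) ⧸ K.prod ⊤ := fun p => QuotientGroup.mk (p.out, 1)
  have htoFun : ∀ g : G, ∀ a : A, toFun (QuotientGroup.mk (g, a)) = QuotientGroup.mk g := by
    intro g a
    have h := QuotientGroup.out_eq' (QuotientGroup.mk (g, a) : (G × A) ⧸ K.prod ⊤)
    have h' : (QuotientGroup.mk ((QuotientGroup.mk (g, a) : (G × A) ⧸ K.prod ⊤).out.1, (QuotientGroup.mk (g, a) : (G × A) ⧸ K.prod ⊤).out.2) :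
        (G × A) ⧸ K.prod ⊤) = QuotientGroup.mk (g, a) := by
      simpa only [Prod.mk.eta] using h
    exact (mk_prod_eq_mk_prod_iff K _ _ _ _).1 h'
  refine ⟨⟨toFun, invFun, fun q => ?_, fun p => ?_⟩, htoFun, fun γ α q => ?_⟩
  · -- left inverse
    induction q using QuotientGroup.induction_on with
    | H x =>
      obtain ⟨g, a⟩ := x
      show QuotientGroup.mk ((toFun (QuotientGroup.mk (g, a))).out, (1 : A)) = QuotientGroup.mk (g, a)
      rw [htoFun, mk_prod_eq_mk_prod_iff, QuotientGroup.out_eq']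
  · -- right inverse
    show toFun (QuotientGroup.mk (p.out, 1)) = p
    rw [htoFun, QuotientGroup.out_eq']
  · induction q using QuotientGroup.induction_on with
    | H x =>
      obtain ⟨g, a⟩ := x
      show toFun ((γ, α) • (QuotientGroup.mk (g, a) : (G × A) ⧸ K.prod ⊤)) = γ • toFun (QuotientGroup.mk (g, a))
      rw [htoFun g a, MulAction.Quotient.smul_mk, MulAction.Quotient.smul_mk, smul_eq_mul, smul_eq_mul, Prod.mk_mul_mk, htoFun]

/-- Fixed points correspond: `q ∈ Fix_{(γ,α)}` iff `e q ∈ Fix_γ`, for any equivariant `e` as above. [cite: BourbakiAlgebraI1989, Ch. I §5 no. 5] -/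
theorem mem_fixedBy_prod_iff (e : (G × A) ⧸ K.prod ⊤ ≃ G ⧸ K) (he : ∀ (γ : G) (α : A) (q : (G × A) ⧸ K.prod ⊤), e ((γ, α) • q) = γ • e q)
    (γ : G) (α : A) (q : (G × A) ⧸ K.prod ⊤) :
    q ∈ fixedBy ((G × A) ⧸ K.prod ⊤) (γ, α) ↔ e q ∈ fixedBy (G ⧸ K) γ := by
  rw [mem_fixedBy, mem_fixedBy, ← he, e.apply_eq_iff_eq]

/-- The equivariant bijection restricts to the fixed-point sets. [cite: BourbakiAlgebraI1989, Ch. I §5 no. 5] -/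
theorem image_fixedBy_prod_eq (e : (G × A) ⧸ K.prod ⊤ ≃ G ⧸ K) (he : ∀ (γ : G) (α : A) (q : (G × A) ⧸ K.prod ⊤), e ((γ, α) • q) = γ • e q)
    (γ : G) (α : A) : e '' fixedBy ((G × A) ⧸ K.prod ⊤) (γ, α) = fixedBy (G ⧸ K) γ := by
  ext p
  constructor
  · rintro ⟨q, hq, rfl⟩; exact (mem_fixedBy_prod_iff K e he γ α q).1 hq
  · intro hp; exact ⟨e.symm p, (mem_fixedBy_prod_iff K e he γ α _).2 (by simpa using hp), e.apply_symm_apply p⟩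

/-- **Fixed-point counts agree**: `#Fix_{(γ,α)}((G × A) ⧸ (K × A)) = #Fix_γ(G ⧸ K)`. [cite: BourbakiAlgebraI1989, Ch. I §5 no. 5] -/
theorem natCard_fixedBy_quotient_prod_top_eq (γ : G) (α : A) :
    Nat.card (fixedBy ((G × A) ⧸ K.prod ⊤) (γ, α)) = Nat.card (fixedBy (G ⧸ K) γ) := by
  obtain ⟨e, -, he⟩ := exists_equiv_quotient_prod_top (A := A) K
  rw [← image_fixedBy_prod_eq K e he γ α, Nat.card_image_of_injective e.injective]

/-- **Stratified fixed-point counts agree**: for any predicate `p` on `G ⧸ K`, `#{q ∈ Fix_{(γ,α)} | p (e q)} = #{p′ ∈ Fix_γ | p p′}` (the depth strata of the road).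
[cite: BourbakiAlgebraI1989, Ch. I §5 no. 5] -/
theorem ncard_sep_fixedBy_quotient_prod_top_eq (e : (G × A) ⧸ K.prod ⊤ ≃ G ⧸ K)
    (he : ∀ (γ : G) (α : A) (q : (G × A) ⧸ K.prod ⊤), e ((γ, α) • q) = γ • e q) (γ : G) (α : A) (p : G ⧸ K → Prop) :
    {q ∈ fixedBy ((G × A) ⧸ K.prod ⊤) (γ, α) | p (e q)}.ncard = {p' ∈ fixedBy (G ⧸ K) γ | p p'}.ncard := by
  have himg : e '' {q ∈ fixedBy ((G × A) ⧸ K.prod ⊤) (γ, α) | p (e q)} = {p' ∈ fixedBy (G ⧸ K) γ | p p'} := by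
    ext p'
    constructor
    · rintro ⟨q, ⟨hq, hpq⟩, rfl⟩; exact ⟨(mem_fixedBy_prod_iff K e he γ α q).1 hq, hpq⟩
    · rintro ⟨hp', hpp'⟩
      exact ⟨e.symm p', ⟨(mem_fixedBy_prod_iff K e he γ α _).2 (by simpa using hp'), by simpa using hpp'⟩, e.apply_symm_apply p'⟩
  rw [← himg, Set.ncard_image_of_injective _ e.injective]

/-- **Values at representatives agree** for a function invariant under conjugation by `K × A`:
`f (q.out⁻¹ (γ, α) q.out) = f ((e q).out⁻¹ γ (e q).out, α)` (both arguments are `K × A`-conjugate). [cite: BourbakiAlgebraI1989, Ch. I §5 no. 5] -/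
theorem apply_out_conj_eq_of_conj_invariant {E : Type*} (e : (G × A) ⧸ K.prod ⊤ ≃ G ⧸ K) (he1 : ∀ g : G, ∀ a : A, e (QuotientGroup.mk (g, a)) = QuotientGroup.mk g)
    (f : G × A → E) (hf : ∀ k ∈ K.prod ⊤, ∀ x, f (k * x * k⁻¹) = f x) (γ : G) (α : A) (q : (G × A) ⧸ K.prod ⊤) :
    f (q.out⁻¹ * (γ, α) * q.out) = f (((e q).out⁻¹ * γ * (e q).out, α)) := by
  -- `q.out = (g, a)`, `(e q).out = g k` with `k ∈ K`
  set g := q.out.1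
  set a := q.out.2
  have hq : e q = QuotientGroup.mk g := by
    conv_lhs => rw [← QuotientGroup.out_eq' q]
    rw [show q.out = (g, a) from rfl, he1]
  have hk : g⁻¹ * (e q).out ∈ K := by
    rw [← QuotientGroup.eq, ← hq, QuotientGroup.out_eq']
  -- `(e q).out⁻¹ γ (e q).out = k⁻¹ (g⁻¹ γ g) k` with `k := g⁻¹ (e q).out ∈ K`; conjugate by `c := (k⁻¹, a) ∈ K × A`
  have hc : (((g⁻¹ * (e q).out)⁻¹, a) : G × A) ∈ K.prod ⊤ := Subgroup.mem_prod.2 ⟨K.inv_mem hk, Subgroup.mem_top _⟩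
  have hconj : (((e q).out⁻¹ * γ * (e q).out, α) : G × A) =
      ((g⁻¹ * (e q).out)⁻¹, a) * (q.out⁻¹ * (γ, α) * q.out) * ((g⁻¹ * (e q).out)⁻¹, a)⁻¹ := by
    rw [show q.out = (g, a) from rfl]
    simp only [Prod.inv_mk, Prod.mk_mul_mk, mul_inv_rev, inv_inv, Prod.mk.injEq]
    constructor
    · group
    · group
  rw [hconj, hf _ hc]

/-- **Fixed-point sums agree**: `Σᶠ_{q ∈ Fix_{(γ,α)}} f (q.out⁻¹ (γ,α) q.out) = Σᶠ_{p ∈ Fix_γ(G ⧸ K)} f (p.out⁻¹ γ p.out, α)` for `f` invariant under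
conjugation by `K × A` — the finite-group unfolding of an orbital integral on `G × A` (★ `OrbitalIntegralFixedPointWeighted`) is the unfolding on `G`. [cite: BourbakiAlgebraI1989, Ch. I §5 no. 5] [cite: Laumon1995, Lemma (5.3.2) p. 136] -/
theorem finsum_mem_fixedBy_quotient_prod_top_eq {E : Type*} [AddCommMonoid E] (f : G × A → E) (hf : ∀ k ∈ K.prod ⊤, ∀ x, f (k * x * k⁻¹) = f x)
    (γ : G) (α : A) :
    ∑ᶠ q ∈ fixedBy ((G × A) ⧸ K.prod ⊤) (γ, α), f (q.out⁻¹ * (γ, α) * q.out) =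
      ∑ᶠ p ∈ fixedBy (G ⧸ K) γ, f (p.out⁻¹ * γ * p.out, α) := by
  obtain ⟨e, he1, he⟩ := exists_equiv_quotient_prod_top (A := A) K
  calc ∑ᶠ q ∈ fixedBy ((G × A) ⧸ K.prod ⊤) (γ, α), f (q.out⁻¹ * (γ, α) * q.out)
      = ∑ᶠ q ∈ fixedBy ((G × A) ⧸ K.prod ⊤) (γ, α), f (((e q).out⁻¹ * γ * (e q).out, α)) :=
        finsum_mem_congr rfl fun q _ => apply_out_conj_eq_of_conj_invariant K e he1 f hf γ α q
    _ = ∑ᶠ p ∈ e '' fixedBy ((G × A) ⧸ K.prod ⊤) (γ, α), f (p.out⁻¹ * γ * p.out, α) :=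
        (finsum_mem_image (f := fun p : G ⧸ K => f (p.out⁻¹ * γ * p.out, α)) e.injective.injOn).symm
    _ = ∑ᶠ p ∈ fixedBy (G ⧸ K) γ, f (p.out⁻¹ * γ * p.out, α) := by rw [image_fixedBy_prod_eq K e he γ α]

end Literature.GroupTheory
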